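import Literature.MathematicalPhysics.QuantumFieldTheory.Balaban1983to89.Node00.Record13NumericsOfThm1CC1
import Literature.MathematicalPhysics.QuantumFieldTheory.Balaban1983to89.Node00.Record13SepBgRowOfThm1C
import Literature.MathematicalPhysics.QuantumFieldTheory.Balaban1983to89.Node00.Record12BgRowGaugeC1Letters

/-!
# NODE 00 (YM-PLAN Track A) — STAGE 13, REV 18: THE SEPARATION-GUARDED ROW P11 PER PARTITION-COMPATIBLE RUN FROM TWO CLASS CLAUSES — node00-def-P11's FACT-FREE
# `bgRowAt_of_classBoundsC1` (FILE 7b) LIFTED TO THE STAGE-13 PARAMETER, AT `θ` AND AT THE WITNESS OF THE C¹ ROUTE `θ₁₅ᶜᶜ¹ = theta13OfThm1CC1` (every numerics face a theorem there)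

Cell `pub-ymgap`, seat `pub-ymgap-node00-def-K0a` (g6), FILE 13b (companions: 13a `Node00/Record13NumericsOfThm1CC1` — the numerics∕witness; 13c
`Node00/Record13SepInhabitedOfClassC1` — the K0⁗ body).  [15] = [Balaban1985Variational], [6] = [Balaban1985RegularSpaces], [III] = [Balaban1988Convergent], [I] = [Balaban1987RG1].

WHY FACT-AGNOSTIC (the re-cut of FILE 12b).  FILE 12b keyed row P11 on node00-def-P11's named fact `VariationalThm1ScaledSep` ([15] Thm 1 (7)–(8), per-scale reading) plus the
displayed derivative members (h3I)∕(h3MS).  Since then (a) node00-def-P11's FILE 7b `bgRowAt_of_classBoundsC1` consumes NO named fact: the row's body at a sequence `s` follows from TWO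
CLASS CLAUSES on def-R's background `UbgMSOfRecord … s W` over the regular retained data `W ∈ regSuppOfRecord …` admitting a minimiser in print's class (`W ∈ solvableDom …`) —
the C⁰ clause `PlaqSmallOn (omegaPlaqs s.Ω m) (B₃·(cR·ε_m)·η_m²)` ((8), node00-def-P11's `plaqSmallOn_UbgMSOfRecord_of_…` currency VERBATIM) and the C¹ clause
`PlaqC1SmallOn (plaqInside (s.Ω m)) (B₃′·(cR·ε_m)·η_m³)` ((9)–(10), gauge-free reading; `h3I`∕`h3MS` are THEOREMS of it by FILE 7b) — plus numerics, (C1)(C2), no wrapping and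
two scale-free letters; (b) dag-n07-e g6 LOCATED-MIXED: the EXISTENCE conjunct of the typed fact admits a cross-scale-incompatible datum, so `VariationalThm1ScaledSep` is refuted for
every `B₃` (`Summit…N07Thm1MixedPlaquetteObstruction`), while its REGULARITY conjunct — the only one any consumer reads — is untouched; at that datum `W ∉ solvableDom` (fibre ∩
class = ∅), so the class clauses below are NOT hit.  This file therefore DISPLAYS the two clauses at the run objects and mentions no named fact: whichever [15]-fact is of record
(node00-def-P11's pen, director-ym LINE №141) supplies the C⁰ clause by its `plaqSmallOn_UbgMSOfRecord_of_<fact>` on the stub side, with no change here.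

WHAT THIS FILE PROVES (theorems only).
* §1 ★ `Stage13Params.bgSepAt_of_classBoundsC1` — node00-def-P11's `bgRowAt_of_classBoundsC1` LIFTED TO θ PER PARTITION-COMPATIBLE RUN: from the signs, the numerics letters
  (displayed: `0 ≤ cR·ε_m`, (hBα), no-wrap, `cB > 2(d−1)LM`, `BCM > 2(d−1)M`, chart reachability ×2, (C1), the two C¹-route letters (hletterI)∕(hletterMS)) and the two class
  clauses (hclass)∕(hclassC1) — conclusion VERBATIM the body of v1.2's `Provisos₁₃Sep.bg` (FILE 12b's shape); (C2) from the run-level antecedent `PartCompat₁₃`; NO (hcomp), NO (hnum).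
* §2 AT `θ₁₅ᶜᶜ¹`: EVERY numerics face is a theorem — `hnum_`∕`hε0_`∕`hg_`∕`hpq_`∕`hBα_`∕`hsN_`∕`hcB_`∕`hBCM_`∕`hsmallI_`∕`hsmallMS_`∕`hC1_`∕`hletterI_`∕`hletterMS_theta13OfThm1CC1` and
  `hcomp_theta13OfThm1CC1_of_monotone` — INCLUDING the ones §1 no longer consumes ((hnum), (hcomp)), for the stub provers deriving the C⁰ clause from a comparable-threshold fact.
* §3 ★★★ `bgSepAt_theta13OfThm1CC1_of_classBounds (hε hε' hB hB' ha₀ ha₁) (hclass) (hclassC1)` — the v1.2 row P11 at `θ₁₅ᶜᶜ¹` ⟸ THE TWO CLASS CLAUSES THERE, NOTHING ELSE.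

HONEST FRAMING.  Composition of tree theorems + elementary inequalities + index bookkeeping; CONDITIONAL on the two DISPLAYED class clauses ([15] Thm 1 (8)–(10)'s regularity
half for def-R's background over print's separated sequences — `Prop` hypotheses, NEVER asserted; node00-def-P11 ∕ dag-n07-e lane); nothing of Bałaban asserted; NOT a discharge;
K0⁗ NOT closed; counts unmoved (typed 28∕28 · discharged 5∕28); one finite 𝕋⁴ programme at fixed ε — NOT continuum ∕ OS ∕ mass gap ∕ Clay.  No `sorry`, `axiom`, `def`, `instance`, `notation`.
-/

noncomputable section

open MeasureTheory
open scoped Matrix.Norms.L2Operator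

namespace Literature.MathematicalPhysics.QuantumFieldTheory.Balaban1983to89.Node00

open T4Continuum B14.Eq218Concrete B15DeterminingSets B12RegularSpaces111 B14RegularSpaces234 B14Radii T4AxialGaugeSmallField

/-! ## §1. ★ node00-def-P11's FACT-FREE `bgRowAt_of_classBoundsC1` LIFTED TO THE STAGE-13 PARAMETER, PER PARTITION-COMPATIBLE RUN (every hypothesis displayed) -/

section LiftAt

variable {F : T4Family} {N : ℕ} [NeZero N]

/-- **★ THE SEPARATION-GUARDED ROW P11 AT THE STAGE-13 RECORD, PER PARTITION-COMPATIBLE RUN, FROM TWO CLASS CLAUSES** — node00-def-P11's `bgRowAt_of_classBoundsC1` at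
`S := settingOfRecord₁₃ F N θ p`, level by level (level `0` vacuous; level `n + 1` after `UbgOfRecord₁₃_succ`), with `b m := B₃·(cR·ε_m)`, `b′ m := B₃′·(cR·ε_m)`, the positivity
of the radii from admissibility in the window (`alphaPos₁₃_of_inInterval`) and (C2) from the run-level antecedent `PartCompat₁₃ F N θ p n`: at every run `p`, level `n ≤ K` in the
window with compatible partitions, SEPARATED `s`, retained `𝐖`, scale `1 ≤ j ≤ n`, domain `X` — the two guarded memberships.  The class clauses (hclass)∕(hclassC1) are the located
readings of [15] Thm 1 (8) and (9)–(10) for def-R's background of the sequence; every other hypothesis is a numerics letter.  A REDUCTION — nothing of Bałaban asserted.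
[cite: Balaban1985Variational, Thm 1 (8)–(10) p.279; Balaban1985RegularSpaces, (1.3)–(1.8) p.77; Balaban1988Convergent, (2.10) p.256, (2.27)–(2.28) p.259, (2.34)–(2.41) p.261, p.257; Balaban1987RG1, (1.11)–(1.16) p.262] -/
theorem Stage13Params.bgSepAt_of_classBoundsC1 (θ : Stage13Params F N) (hθ : θ.Admissible F N) (hRz : θ.Rz = RzOfRecord F N)
    {B₃ B₃' : ℝ} (hB₃ : 0 ≤ B₃) (hB₃' : 0 ≤ B₃') (hM : 0 < θ.τ9.M)
    (hε0 : ∀ (p : B12.RunParams) (n : ℕ), n ≤ p.K → Step.InInterval θ.γ n (gOfRecord₁₃ F N θ p) → ∀ m, m ≤ n → 0 ≤ θ.s2.cR * epsOfRecord θ.ν (gOfRecord₁₃ F N θ p) m)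
    (hBα : ∀ (p : B12.RunParams) (n : ℕ), n ≤ p.K → Step.InInterval θ.γ n (gOfRecord₁₃ F N θ p) → ∀ m, 1 ≤ m → m ≤ n →
      B₃ * (θ.s2.cR * epsOfRecord θ.ν (gOfRecord₁₃ F N θ p) m) ≤ (1 - θ.s2.βc) * (lfOfRecord₁₂ F N θ.toStage12Params).alpha0 (gOfRecord₁₃ F N θ p m))
    (hsN : ∀ (p : B12.RunParams) (n : ℕ), n ≤ p.K → ∀ n', 1 ≤ n' → n' ≤ n + 1 →
      ((B14.Eq213MaximalDomains.side (F.P p.K).L θ.τ9.M n' : ℕ) : ℤ) < (F.P p.K).sitesPerDir 0)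
    (hcB : ∀ p : B12.RunParams, 2 * (((F.P p.K).d - 1 : ℕ) : ℝ) * ((F.P p.K).L * θ.τ9.M) < θ.s2.cB)
    (hBCM : ∀ p : B12.RunParams, 2 * (((F.P p.K).d - 1 : ℕ) : ℝ) * θ.τ9.M < θ.s2.B * θ.s2.C * θ.s2.Mr)
    (hsmallI : ∀ (p : B12.RunParams) (n : ℕ), n ≤ p.K → Step.InInterval θ.γ n (gOfRecord₁₃ F N θ p) → ∀ j, 1 ≤ j → j ≤ n →
      (((F.P p.K).d - 1 : ℕ) : ℝ) * ((F.P p.K).L * θ.τ9.M) * (F.P p.K).eta j * (B₃ * (θ.s2.cR * epsOfRecord θ.ν (gOfRecord₁₃ F N θ p) j)) ≤ 1 / 2)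
    (hsmallMS : ∀ (p : B12.RunParams) (n : ℕ), n ≤ p.K → Step.InInterval θ.γ n (gOfRecord₁₃ F N θ p) → ∀ m, 1 ≤ m → m ≤ n →
      (((F.P p.K).d - 1 : ℕ) : ℝ) * θ.τ9.M * (F.P p.K).eta m * (B₃ * (θ.s2.cR * epsOfRecord θ.ν (gOfRecord₁₃ F N θ p) m)) ≤ 1 / 2)
    (hC1 : ∀ (p : B12.RunParams) (n : ℕ), n ≤ p.K → Step.InInterval θ.γ n (gOfRecord₁₃ F N θ p) → ∀ j, 1 ≤ j → j ≤ n →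
      ∃ t : ℕ, 0 < t ∧ RkOfRecord (F.P p.K).L θ.ν.r (gOfRecord₁₃ F N θ p j) = (F.P p.K).L * t)
    (hletterI : ∀ (p : B12.RunParams) (n : ℕ), n ≤ p.K → Step.InInterval θ.γ n (gOfRecord₁₃ F N θ p) → ∀ j, 1 ≤ j → j ≤ n →
      4 * (B₃ * (θ.s2.cR * epsOfRecord θ.ν (gOfRecord₁₃ F N θ p) j) + (((F.P p.K).d - 1 : ℕ) : ℝ) * (((F.P p.K).L : ℝ) * θ.τ9.M) * (B₃' * (θ.s2.cR * epsOfRecord θ.ν (gOfRecord₁₃ F N θ p) j)) +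
        4 * ((((F.P p.K).d - 1 : ℕ) : ℝ) * (((F.P p.K).L : ℝ) * θ.τ9.M)) ^ 2 * (B₃ * (θ.s2.cR * epsOfRecord θ.ν (gOfRecord₁₃ F N θ p) j)) ^ 2) <
        θ.s2.cB * (lfOfRecord₁₂ F N θ.toStage12Params).alpha0 (gOfRecord₁₃ F N θ p j))
    (hletterMS : ∀ (p : B12.RunParams) (n : ℕ), n ≤ p.K → Step.InInterval θ.γ n (gOfRecord₁₃ F N θ p) → ∀ m, 1 ≤ m → m ≤ n →
      4 * (B₃ * (θ.s2.cR * epsOfRecord θ.ν (gOfRecord₁₃ F N θ p) m) + (((F.P p.K).d - 1 : ℕ) : ℝ) * (θ.τ9.M : ℝ) * (B₃' * (θ.s2.cR * epsOfRecord θ.ν (gOfRecord₁₃ F N θ p) m)) +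
        4 * ((((F.P p.K).d - 1 : ℕ) : ℝ) * (θ.τ9.M : ℝ)) ^ 2 * (B₃ * (θ.s2.cR * epsOfRecord θ.ν (gOfRecord₁₃ F N θ p) m)) ^ 2) <
        rad238 θ.s2.B θ.s2.C θ.s2.Mr ((lfOfRecord₁₂ F N θ.toStage12Params).alpha0 (gOfRecord₁₃ F N θ p m)))
    (hclass : ∀ (p : B12.RunParams) (n : ℕ), n ≤ p.K → Step.InInterval θ.γ n (gOfRecord₁₃ F N θ p) → PartCompat₁₃ F N θ p n →
      ∀ s : SeqOfRecord F θ.ν θ.τ9.M (gOfRecord₁₃ F N θ p) p.K n, Sect2.SeqSeparated θ.ν.M₁ s → ∀ W : MSField (F.P p.K) (SU N),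
      W ∈ suppOfRecord₁₃ F N θ p n s → W ∈ solvableDom (avOfRecord F N p.K) (regMSOfRecord F N θ.ν p.K n s.Ω) (genSet s.Ω n) →
      ∀ m, m ≤ n → PlaqSmallOn (omegaPlaqs s.Ω m) (B₃ * (θ.s2.cR * epsOfRecord θ.ν (gOfRecord₁₃ F N θ p) m) * (F.P p.K).eta m ^ 2)
        (UbgMSOfRecord F N θ.ν θ.τ9.M (gOfRecord₁₃ F N θ p) p.K n s W))
    (hclassC1 : ∀ (p : B12.RunParams) (n : ℕ), n ≤ p.K → Step.InInterval θ.γ n (gOfRecord₁₃ F N θ p) → PartCompat₁₃ F N θ p n →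
      ∀ s : SeqOfRecord F θ.ν θ.τ9.M (gOfRecord₁₃ F N θ p) p.K n, Sect2.SeqSeparated θ.ν.M₁ s → ∀ W : MSField (F.P p.K) (SU N),
      W ∈ suppOfRecord₁₃ F N θ p n s → W ∈ solvableDom (avOfRecord F N p.K) (regMSOfRecord F N θ.ν p.K n s.Ω) (genSet s.Ω n) →
      ∀ m, 1 ≤ m → m ≤ n → PlaqC1SmallOn (plaqInside (s.Ω m)) (B₃' * (θ.s2.cR * epsOfRecord θ.ν (gOfRecord₁₃ F N θ p) m) * (F.P p.K).eta m ^ 3)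
        (UbgMSOfRecord F N θ.ν θ.τ9.M (gOfRecord₁₃ F N θ p) p.K n s W)) :
    ∀ (p : B12.RunParams) (n : ℕ), n ≤ p.K → Step.InInterval θ.γ n (gOfRecord₁₃ F N θ p) → PartCompat₁₃ F N θ p n →
      ∀ s : SeqOfRecord F θ.ν θ.τ9.M (gOfRecord₁₃ F N θ p) p.K n, Sect2.SeqSeparated θ.ν.M₁ s →
      ∀ W : MSField (F.P p.K) (SU N), W ∈ suppOfRecord₁₃ F N θ p n s →
      ∀ j, 1 ≤ j → j ≤ n → ∀ X : (Sect2.domSys (F.P p.K) θ.τ9.M j).Dom,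
      (Sect2.domSites (F.P p.K) θ.τ9.M j X ⊆ s.Λ j →
        Sect2.ofBackgroundC (settingOfRecord₁₃ F N θ p).ι (UbgOfRecord₁₃ F N θ p n s W) ∈
          Sect2.spaceI (settingOfRecord₁₃ F N θ p) (θ.Rz p.K) θ.τ9.M j (Sect2.domSites (F.P p.K) θ.τ9.M j X)
            ((settingOfRecord₁₃ F N θ p).lf.alpha0 ((settingOfRecord₁₃ F N θ p).flow.g j)) ((settingOfRecord₁₃ F N θ p).lf.alpha1 ((settingOfRecord₁₃ F N θ p).flow.g j))) ∧
      (Sect2.admB (F.P p.K) θ.ν θ.τ9.M (gOfRecord₁₃ F N θ p) s.Ω s.Λ j (Sect2.domSites (F.P p.K) θ.τ9.M j X) = true →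
        Sect2.ofBackgroundC (settingOfRecord₁₃ F N θ p).ι (UbgOfRecord₁₃ F N θ p n s W) ∈
          Sect2.spaceMS (settingOfRecord₁₃ F N θ p) (θ.Rz p.K) θ.τ9.M j (Sect2.domSites (F.P p.K) θ.τ9.M j X) s.Ω) := by
  intro p n hn hw hpc
  rw [hRz]
  cases n with
  | zero =>
    intro s _ W _ j h1 hj
    exfalso
    omega
  | succ n =>
    rw [UbgOfRecord₁₃_succ]
    exact fun s hsep W hW j h1 hj X =>
      bgRowAt_of_classBoundsC1 (settingOfRecord₁₃ F N θ p) rfl rfl (settingOfRecord₁₃_laws F N θ p) (settingOfRecord₁₃_pos F N θ hθ.1.pos p) θ.ν hM p.K (n + 1) θ.s2.cR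
        (b := fun m => B₃ * (θ.s2.cR * epsOfRecord θ.ν (gOfRecord₁₃ F N θ p) m)) (b' := fun m => B₃' * (θ.s2.cR * epsOfRecord θ.ν (gOfRecord₁₃ F N θ p) m))
        (fun m hm => mul_nonneg hB₃ (hε0 p (n + 1) hn hw m hm)) (fun m hm => mul_nonneg hB₃' (hε0 p (n + 1) hn hw m hm)) s
        (hclass p (n + 1) hn hw hpc s hsep) (hclassC1 p (n + 1) hn hw hpc s hsep) (fun m _ hm => alphaPos₁₃_of_inInterval hθ hw hm)
        (hBα p (n + 1) hn hw) (hsN p (n + 1) hn) (hcB p) (hBCM p) (hsmallI p (n + 1) hn hw) (hsmallMS p (n + 1) hn hw) (hC1 p (n + 1) hn hw) hpc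
        (hletterI p (n + 1) hn hw) (hletterMS p (n + 1) hn hw) W hW j h1 hj X

end LiftAt

/-! ## §2. AT THE WITNESS OF THE C¹ ROUTE `θ₁₅ᶜᶜ¹`: every numerics face is a theorem -/

section Faces

variable {F : T4Family} {N : ℕ} [NeZero N] {ε₀ ε₂₉ B₃ B₃' a₀ a₁ : ℝ}

/-- **node00-def-P11's (hnum) AT `θ₁₅ᶜᶜ¹`** along every windowed run (for the stub provers: the C⁰ clause from a [15]-fact needs `0 < cR·ε_m ≤ a₁`, `B₃·cR·ε_m ≤ εreg = a₀`).
[cite: Balaban1988Convergent, (2.4) p.255, (2.12) p.256; Balaban1985Variational, Thm 1 (7)–(8) p.279] -/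
theorem hnum_theta13OfThm1CC1 (hB : 0 ≤ B₃) (hB' : 0 ≤ B₃') (ha₀ : 0 < a₀) (ha₁ : 0 < a₁) :
     ∀ (p : B12.RunParams) (n : ℕ), n ≤ p.K → Step.InInterval (theta13OfThm1CC1 F N ε₀ ε₂₉ B₃ B₃' a₀ a₁).γ n (gOfRecord₁₃ F N (theta13OfThm1CC1 F N ε₀ ε₂₉ B₃ B₃' a₀ a₁) p) → ∀ m, m ≤ n →
      0 < (theta13OfThm1CC1 F N ε₀ ε₂₉ B₃ B₃' a₀ a₁).s2.cR * epsOfRecord (theta13OfThm1CC1 F N ε₀ ε₂₉ B₃ B₃' a₀ a₁).ν (gOfRecord₁₃ F N (theta13OfThm1CC1 F N ε₀ ε₂₉ B₃ B₃' a₀ a₁) p) m ∧ (theta13OfThm1CC1 F N ε₀ ε₂₉ B₃ B₃' a₀ a₁).s2.cR * epsOfRecord (theta13OfThm1CC1 F N ε₀ ε₂₉ B₃ B₃' a₀ a₁).ν (gOfRecord₁₃ F N (theta13OfThm1CC1 F N ε₀ ε₂₉ B₃ B₃' a₀ a₁) p) m ≤ a₁ ∧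
        B₃ * ((theta13OfThm1CC1 F N ε₀ ε₂₉ B₃ B₃' a₀ a₁).s2.cR * epsOfRecord (theta13OfThm1CC1 F N ε₀ ε₂₉ B₃ B₃' a₀ a₁).ν (gOfRecord₁₃ F N (theta13OfThm1CC1 F N ε₀ ε₂₉ B₃ B₃' a₀ a₁) p) m) ≤ (theta13OfThm1CC1 F N ε₀ ε₂₉ B₃ B₃' a₀ a₁).ν.εreg :=
  fun _ _ _ hw => numerics_thm1CC1_of_inInterval hB hB' ha₀ ha₁ (by norm_num : (1 / 2 : ℝ) < 1) hw

/-- `θ₁₅ᶜᶜ¹.ν.εreg ≤ a₀` (it IS `a₀`). [cite: Balaban1985Variational, Thm 1 (8) p.279 (bookkeeping)] -/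
theorem εreg_le_theta13OfThm1CC1 : (theta13OfThm1CC1 F N ε₀ ε₂₉ B₃ B₃' a₀ a₁).ν.εreg ≤ a₀ := (theta13OfThm1CC1_εreg F N ε₀ ε₂₉ B₃ B₃' a₀ a₁).le

/-- **`0 ≤ cR·ε_m` AT `θ₁₅ᶜᶜ¹`** along every windowed run. [cite: Balaban1988Convergent, (2.4) p.255, (2.10) p.256 (bookkeeping)] -/
theorem hε0_theta13OfThm1CC1 (hB : 0 ≤ B₃) (hB' : 0 ≤ B₃') (ha₀ : 0 < a₀) (ha₁ : 0 < a₁) :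
     ∀ (p : B12.RunParams) (n : ℕ), n ≤ p.K → Step.InInterval (theta13OfThm1CC1 F N ε₀ ε₂₉ B₃ B₃' a₀ a₁).γ n (gOfRecord₁₃ F N (theta13OfThm1CC1 F N ε₀ ε₂₉ B₃ B₃' a₀ a₁) p) → ∀ m, m ≤ n → 0 ≤ (theta13OfThm1CC1 F N ε₀ ε₂₉ B₃ B₃' a₀ a₁).s2.cR * epsOfRecord (theta13OfThm1CC1 F N ε₀ ε₂₉ B₃ B₃' a₀ a₁).ν (gOfRecord₁₃ F N (theta13OfThm1CC1 F N ε₀ ε₂₉ B₃ B₃' a₀ a₁) p) m :=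
  fun p n hn hw m hm => (hnum_theta13OfThm1CC1 hB hB' ha₀ ha₁ p n hn hw m hm).1.le

/-- **THE WINDOW LETTERS AT `θ₁₅ᶜᶜ¹`**: `0 < g_m`, `g_m² ≤ ¼ ≤ e⁻¹` along every windowed run (`γ = ½`). [cite: Balaban1987RG1, Thm 1 p.255; Balaban1988Convergent, (2.4) p.255 (bookkeeping)] -/
theorem hg_theta13OfThm1CC1 :
     ∀ (p : B12.RunParams) (n : ℕ), n ≤ p.K → Step.InInterval (theta13OfThm1CC1 F N ε₀ ε₂₉ B₃ B₃' a₀ a₁).γ n (gOfRecord₁₃ F N (theta13OfThm1CC1 F N ε₀ ε₂₉ B₃ B₃' a₀ a₁) p) → ∀ m, m ≤ n → 0 < gOfRecord₁₃ F N (theta13OfThm1CC1 F N ε₀ ε₂₉ B₃ B₃' a₀ a₁) p m ∧ gOfRecord₁₃ F N (theta13OfThm1CC1 F N ε₀ ε₂₉ B₃ B₃' a₀ a₁) p m ^ 2 ≤ Real.exp (-1) :=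
  fun _ _ _ hw => window_sq_le_of_inInterval (theta13OfThm1CC1_γ F N ε₀ ε₂₉ B₃ B₃' a₀ a₁).le hw

/-- **`p₀ ≤ q₀` AT `θ₁₅ᶜᶜ¹`** (`1 ≤ 2`). [cite: Balaban1988Convergent, (2.4) p.255, (2.28) p.259 (bookkeeping)] -/
theorem hpq_theta13OfThm1CC1 : (theta13OfThm1CC1 F N ε₀ ε₂₉ B₃ B₃' a₀ a₁).ν.p₀ ≤ (lfOfRecord₁₂ F N (theta13OfThm1CC1 F N ε₀ ε₂₉ B₃ B₃' a₀ a₁).toStage12Params).q₀ := by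
  rw [theta13OfThm1CC1_p₀, lfOfRecord₁₂_theta13OfThm1CC1]; norm_num [lfConstsOfFamily, lfConstsOfRecord₁₂]

/-- **`α₀(g_j) > 0` AT `θ₁₅ᶜᶜ¹`** along every windowed run (`C₀ = 1 > 0`, `0 < g_j ≤ ½ < 1`). [cite: Balaban1988Convergent, (2.28) p.259 (bookkeeping)] -/
theorem hα0_theta13OfThm1CC1 :
    ∀ (p : B12.RunParams) (n : ℕ), n ≤ p.K → Step.InInterval (theta13OfThm1CC1 F N ε₀ ε₂₉ B₃ B₃' a₀ a₁).γ n (gOfRecord₁₃ F N (theta13OfThm1CC1 F N ε₀ ε₂₉ B₃ B₃' a₀ a₁) p) → ∀ j, j ≤ n →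
      0 < (lfOfRecord₁₂ F N (theta13OfThm1CC1 F N ε₀ ε₂₉ B₃ B₃' a₀ a₁).toStage12Params).alpha0 (gOfRecord₁₃ F N (theta13OfThm1CC1 F N ε₀ ε₂₉ B₃ B₃' a₀ a₁) p j) :=
  fun p n _ hw j hj => alpha0_pos_of_lt_one _ (by rw [lfOfRecord₁₂_theta13OfThm1CC1]; norm_num [lfConstsOfFamily, lfConstsOfRecord₁₂]) (hw j hj).1
    ((hw j hj).2.trans_lt (by rw [theta13OfThm1CC1_γ]; norm_num))

/-- **node00-def-P11's (hBα) AT `θ₁₅ᶜᶜ¹`** (`bg_numerics_of_letters`: `p₀ = 1 ≤ q₀ = 2`, `B₃·A₀ᶜᶜ¹ ≤ ¾·C₀`, `g_m² ≤ e⁻¹`). [cite: Balaban1988Convergent, (2.4) p.255, (2.28) p.259, (2.34) p.261] -/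
theorem hBα_theta13OfThm1CC1 (hB : 0 ≤ B₃) (hB' : 0 ≤ B₃') (ha₀ : 0 ≤ a₀) (ha₁ : 0 ≤ a₁) :
     ∀ (p : B12.RunParams) (n : ℕ), n ≤ p.K → Step.InInterval (theta13OfThm1CC1 F N ε₀ ε₂₉ B₃ B₃' a₀ a₁).γ n (gOfRecord₁₃ F N (theta13OfThm1CC1 F N ε₀ ε₂₉ B₃ B₃' a₀ a₁) p) → ∀ m, 1 ≤ m → m ≤ n →
      B₃ * ((theta13OfThm1CC1 F N ε₀ ε₂₉ B₃ B₃' a₀ a₁).s2.cR * epsOfRecord (theta13OfThm1CC1 F N ε₀ ε₂₉ B₃ B₃' a₀ a₁).ν (gOfRecord₁₃ F N (theta13OfThm1CC1 F N ε₀ ε₂₉ B₃ B₃' a₀ a₁) p) m) ≤ (1 - (theta13OfThm1CC1 F N ε₀ ε₂₉ B₃ B₃' a₀ a₁).s2.βc) * (lfOfRecord₁₂ F N (theta13OfThm1CC1 F N ε₀ ε₂₉ B₃ B₃' a₀ a₁).toStage12Params).alpha0 (gOfRecord₁₃ F N (theta13OfThm1CC1 F N ε₀ ε₂₉ B₃ B₃'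 a₀ a₁) p m) :=
  fun p n _ hw =>
    (theta13OfThm1CC1 F N ε₀ ε₂₉ B₃ B₃' a₀ a₁).bg_numerics_of_letters hpq_theta13OfThm1CC1
      (mul_A0_nonneg_thm1CC1 hB hB' ha₀ ha₁) (mul_A0_le_C₀_thm1CC1 hB hB' ha₀ ha₁) p n (hg_theta13OfThm1CC1 p n ‹_› hw)

/-- **NO WRAPPING AT `θ₁₅ᶜᶜ¹`**: the cubes of record of side `L^{n'}·M = L^{n'}` (`n' ≤ K + 1 ≤ m + K`) are shorter than the torus (`2L^{m+K}` sites per direction).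
[cite: Balaban1987RG1, (0.1) p.251; Balaban1988Convergent, p.257 (bookkeeping)] -/
theorem hsN_theta13OfThm1CC1 :
     ∀ (p : B12.RunParams) (n : ℕ), n ≤ p.K → ∀ n', 1 ≤ n' → n' ≤ n + 1 →
      ((B14.Eq213MaximalDomains.side (F.P p.K).L (theta13OfThm1CC1 F N ε₀ ε₂₉ B₃ B₃' a₀ a₁).τ9.M n' : ℕ) : ℤ) < (F.P p.K).sitesPerDir 0 := by
  intro p n hn n' _ hn'
  rw [theta13OfThm1CC1_τ9_M]
  have hm := F.hm
  have hL : 0 < F.L := by have := F.hL11; omega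
  have hnat : B14.Eq213MaximalDomains.side (F.P p.K).L 1 n' < (F.P p.K).sitesPerDir 0 := by
    show F.L ^ n' * 1 < 2 * F.L ^ (F.m + p.K - 0)
    rw [mul_one, Nat.sub_zero]
    have h1 : F.L ^ n' ≤ F.L ^ (F.m + p.K) := Nat.pow_le_pow_right hL (by omega)
    have h0 : 0 < F.L ^ (F.m + p.K) := Nat.pow_pos hL
    omega
  exact_mod_cast hnat

/-- **«B sufficiently large» AT `θ₁₅ᶜᶜ¹`**: `2(d−1)·L·M = 6L < 6L + 1 = O(1)LMB`. [cite: Balaban1987RG1, (1.12) p.262; Balaban1988Convergent, p.256] -/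
theorem hcB_theta13OfThm1CC1 :
     ∀ p : B12.RunParams, 2 * (((F.P p.K).d - 1 : ℕ) : ℝ) * ((F.P p.K).L * (theta13OfThm1CC1 F N ε₀ ε₂₉ B₃ B₃' a₀ a₁).τ9.M) < (theta13OfThm1CC1 F N ε₀ ε₂₉ B₃ B₃' a₀ a₁).s2.cB := by
  intro p
  rw [theta13OfThm1CC1_cB, theta13OfThm1CC1_τ9_M]
  have hd : (F.P p.K).d = 4 := rfl
  have hL : ((F.P p.K).L : ℝ) = F.L := rfl
  simp only [hd, hL]
  push_cast
  linarith

/-- **`BCM > 2(d−1)M` AT `θ₁₅ᶜᶜ¹`**: `6 < 7`. [cite: Balaban1988Convergent, (2.38) p.261] -/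
theorem hBCM_theta13OfThm1CC1 :
     ∀ p : B12.RunParams, 2 * (((F.P p.K).d - 1 : ℕ) : ℝ) * (theta13OfThm1CC1 F N ε₀ ε₂₉ B₃ B₃' a₀ a₁).τ9.M < (theta13OfThm1CC1 F N ε₀ ε₂₉ B₃ B₃' a₀ a₁).s2.B * (theta13OfThm1CC1 F N ε₀ ε₂₉ B₃ B₃' a₀ a₁).s2.C * (theta13OfThm1CC1 F N ε₀ ε₂₉ B₃ B₃' a₀ a₁).s2.Mr := by
  intro p
  rw [theta13OfThm1CC1_B, theta13OfThm1CC1_C, theta13OfThm1CC1_Mr, theta13OfThm1CC1_τ9_M]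
  have hd : (F.P p.K).d = 4 := rfl
  simp only [hd]
  push_cast
  norm_num

/-- **CHART REACHABILITY ON THE `O(1)LM`-CUBES AT `θ₁₅ᶜᶜ¹`**: `(d−1)·L·M·η_j·(B₃·cR·ε_j) ≤ 3·1·(1∕16) ≤ ½`. [cite: Balaban1987RG1, (1.12) p.262; Balaban1988Convergent, (2.4) p.255, p.256] -/
theorem hsmallI_theta13OfThm1CC1 (hB : 0 ≤ B₃) (hB' : 0 ≤ B₃') (ha₀ : 0 < a₀) (ha₁ : 0 < a₁) :
     ∀ (p : B12.RunParams) (n : ℕ), n ≤ p.K → Step.InInterval (theta13OfThm1CC1 F N ε₀ ε₂₉ B₃ B₃' a₀ a₁).γ n (gOfRecord₁₃ F N (theta13OfThm1CC1 F N ε₀ ε₂₉ B₃ B₃' a₀ a₁) p) → ∀ j, 1 ≤ j → j ≤ n →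
      (((F.P p.K).d - 1 : ℕ) : ℝ) * ((F.P p.K).L * (theta13OfThm1CC1 F N ε₀ ε₂₉ B₃ B₃' a₀ a₁).τ9.M) * (F.P p.K).eta j * (B₃ * ((theta13OfThm1CC1 F N ε₀ ε₂₉ B₃ B₃' a₀ a₁).s2.cR * epsOfRecord (theta13OfThm1CC1 F N ε₀ ε₂₉ B₃ B₃' a₀ a₁).ν (gOfRecord₁₃ F N (theta13OfThm1CC1 F N ε₀ ε₂₉ B₃ B₃' a₀ a₁) p) j)) ≤ 1 / 2 := by
  intro p n _ hw j h1 hj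
  set b := B₃ * ((theta13OfThm1CC1 F N ε₀ ε₂₉ B₃ B₃' a₀ a₁).s2.cR *
    epsOfRecord (theta13OfThm1CC1 F N ε₀ ε₂₉ B₃ B₃' a₀ a₁).ν (gOfRecord₁₃ F N (theta13OfThm1CC1 F N ε₀ ε₂₉ B₃ B₃' a₀ a₁) p) j) with hb_def
  have hb : b ≤ 1 / 16 := mul_epsOfRecord_thm1CC1_le hB hB' ha₀ ha₁ hw hj
  have hb0 : 0 ≤ b := mul_nonneg hB (hnum_theta13OfThm1CC1 hB hB' ha₀ ha₁ p n ‹_› hw j hj).1.le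
  have hLη : ((F.P p.K).L : ℝ) * (F.P p.K).eta j ≤ 1 := cast_mul_eta_le_one (F.P p.K) h1
  have key : ((F.P p.K).L : ℝ) * (F.P p.K).eta j * b ≤ 1 * (1 / 16) := mul_le_mul hLη hb hb0 zero_le_one
  rw [theta13OfThm1CC1_τ9_M]
  have hd : (F.P p.K).d = 4 := rfl
  simp only [hd]
  push_cast
  calc (3 : ℝ) * (((F.P p.K).L : ℝ) * 1) * (F.P p.K).eta j * b = 3 * (((F.P p.K).L : ℝ) * (F.P p.K).eta j * b) := by ring
    _ ≤ 3 * (1 * (1 / 16)) := mul_le_mul_of_nonneg_left key (by norm_num)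
    _ ≤ 1 / 2 := by norm_num

/-- **CHART REACHABILITY ON THE LAYER CUBES AT `θ₁₅ᶜᶜ¹`**: `(d−1)·M·η_m·(B₃·cR·ε_m) ≤ 3·1·(1∕16) ≤ ½`. [cite: Balaban1988Convergent, (2.38) p.261, (2.4) p.255] -/
theorem hsmallMS_theta13OfThm1CC1 (hB : 0 ≤ B₃) (hB' : 0 ≤ B₃') (ha₀ : 0 < a₀) (ha₁ : 0 < a₁) :
     ∀ (p : B12.RunParams) (n : ℕ), n ≤ p.K → Step.InInterval (theta13OfThm1CC1 F N ε₀ ε₂₉ B₃ B₃' a₀ a₁).γ n (gOfRecord₁₃ F N (theta13OfThm1CC1 F N ε₀ ε₂₉ B₃ B₃' a₀ a₁) p) → ∀ m, 1 ≤ m → m ≤ n →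
      (((F.P p.K).d - 1 : ℕ) : ℝ) * (theta13OfThm1CC1 F N ε₀ ε₂₉ B₃ B₃' a₀ a₁).τ9.M * (F.P p.K).eta m * (B₃ * ((theta13OfThm1CC1 F N ε₀ ε₂₉ B₃ B₃' a₀ a₁).s2.cR * epsOfRecord (theta13OfThm1CC1 F N ε₀ ε₂₉ B₃ B₃' a₀ a₁).ν (gOfRecord₁₃ F N (theta13OfThm1CC1 F N ε₀ ε₂₉ B₃ B₃' a₀ a₁) p) m)) ≤ 1 / 2 := by
  intro p n _ hw m _ hm
  set b := B₃ * ((theta13OfThm1CC1 F N ε₀ ε₂₉ B₃ B₃' a₀ a₁).s2.cR *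
    epsOfRecord (theta13OfThm1CC1 F N ε₀ ε₂₉ B₃ B₃' a₀ a₁).ν (gOfRecord₁₃ F N (theta13OfThm1CC1 F N ε₀ ε₂₉ B₃ B₃' a₀ a₁) p) m) with hb_def
  have hb : b ≤ 1 / 16 := mul_epsOfRecord_thm1CC1_le hB hB' ha₀ ha₁ hw hm
  have hb0 : 0 ≤ b := mul_nonneg hB (hnum_theta13OfThm1CC1 hB hB' ha₀ ha₁ p n ‹_› hw m hm).1.le
  have hη : (F.P p.K).eta m ≤ 1 := by
    have hL1 : (1 : ℝ) ≤ (F.P p.K).L := by exact_mod_cast (F.P p.K).L_pos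
    exact pow_le_one₀ (inv_nonneg.mpr (by linarith)) (inv_le_one_of_one_le₀ hL1)
  have key : (F.P p.K).eta m * b ≤ 1 * (1 / 16) := mul_le_mul hη hb hb0 zero_le_one
  rw [theta13OfThm1CC1_τ9_M]
  have hd : (F.P p.K).d = 4 := rfl
  simp only [hd]
  push_cast
  calc (3 : ℝ) * 1 * (F.P p.K).eta m * b = 3 * ((F.P p.K).eta m * b) := by ring
    _ ≤ 3 * (1 * (1 / 16)) := mul_le_mul_of_nonneg_left key (by norm_num)
    _ ≤ 1 / 2 := by norm_num

/-- **(C1) NESTED GRIDS AT `θ₁₅ᶜᶜ¹`**: `R_j = L·t_j` along every windowed run (`exists_RkOfRecord_eq_mul`: `L ≥ 2`, `r = 1`, `log g_j⁻² > 1` in `]0, ½]`). [cite: Balaban1988Convergent, (2.5) p.255, p.257] -/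
theorem hC1_theta13OfThm1CC1 :
     ∀ (p : B12.RunParams) (n : ℕ), n ≤ p.K → Step.InInterval (theta13OfThm1CC1 F N ε₀ ε₂₉ B₃ B₃' a₀ a₁).γ n (gOfRecord₁₃ F N (theta13OfThm1CC1 F N ε₀ ε₂₉ B₃ B₃' a₀ a₁) p) → ∀ j, 1 ≤ j → j ≤ n →
      ∃ t : ℕ, 0 < t ∧ RkOfRecord (F.P p.K).L (theta13OfThm1CC1 F N ε₀ ε₂₉ B₃ B₃' a₀ a₁).ν.r (gOfRecord₁₃ F N (theta13OfThm1CC1 F N ε₀ ε₂₉ B₃ B₃' a₀ a₁) p j) = (F.P p.K).L * t := by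
  intro p n _ hw j _ hj
  have hL : 2 ≤ (F.P p.K).L := by show 2 ≤ F.L; have := F.hL11; omega
  exact exists_RkOfRecord_eq_mul hL (le_of_eq (theta13OfThm1CC1_r F N ε₀ ε₂₉ B₃ B₃' a₀ a₁).symm)
    (one_lt_log_inv_sq_of_le_half (hw j hj).1 ((hw j hj).2.trans (theta13OfThm1CC1_γ F N ε₀ ε₂₉ B₃ B₃' a₀ a₁).le))

/-- **★ node00-def-P11's C¹-ROUTE LETTER (hletterI) AT `θ₁₅ᶜᶜ¹`** (FILE 7c `hletterI_of_numerics` at `t_I = 1 < 6L + 1`: `Λ(L·M)·cR·A₀ᶜᶜ¹ ≤ C₀` by FILE 13a `lambda_mul_A0_le_C₀_thm1CC1`).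
[cite: Balaban1988Convergent, (2.4) p.255, (2.28) p.259; Balaban1987RG1, (1.12) p.262] -/
theorem hletterI_theta13OfThm1CC1 (hB : 0 ≤ B₃) (hB' : 0 ≤ B₃') (ha₀ : 0 < a₀) (ha₁ : 0 < a₁) :
     ∀ (p : B12.RunParams) (n : ℕ), n ≤ p.K → Step.InInterval (theta13OfThm1CC1 F N ε₀ ε₂₉ B₃ B₃' a₀ a₁).γ n (gOfRecord₁₃ F N (theta13OfThm1CC1 F N ε₀ ε₂₉ B₃ B₃' a₀ a₁) p) → ∀ j, 1 ≤ j → j ≤ n →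
      4 * (B₃ * ((theta13OfThm1CC1 F N ε₀ ε₂₉ B₃ B₃' a₀ a₁).s2.cR * epsOfRecord (theta13OfThm1CC1 F N ε₀ ε₂₉ B₃ B₃' a₀ a₁).ν (gOfRecord₁₃ F N (theta13OfThm1CC1 F N ε₀ ε₂₉ B₃ B₃' a₀ a₁) p) j) + (((F.P p.K).d - 1 : ℕ) : ℝ) * (((F.P p.K).L : ℝ) * (theta13OfThm1CC1 F N ε₀ ε₂₉ B₃ B₃' a₀ a₁).τ9.M) * (B₃' * ((theta13OfThm1CC1 F N ε₀ ε₂₉ B₃ B₃' a₀ a₁).s2.cR * epsOfRecord (theta13OfThm1CC1 F N ε₀ ε₂₉ B₃ B₃' a₀ a₁).ν (gOfRecord₁₃ F N (theta13OfThm1CC1 F N ε₀ ε₂₉ B₃ B₃' a₀ a₁) p) j)) +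
        4 * ((((F.P p.K).d - 1 : ℕ) : ℝ) * (((F.P p.K).L : ℝ) * (theta13OfThm1CC1 F N ε₀ ε₂₉ B₃ B₃' a₀ a₁).τ9.M)) ^ 2 * (B₃ * ((theta13OfThm1CC1 F N ε₀ ε₂₉ B₃ B₃' a₀ a₁).s2.cR * epsOfRecord (theta13OfThm1CC1 F N ε₀ ε₂₉ B₃ B₃' a₀ a₁).ν (gOfRecord₁₃ F N (theta13OfThm1CC1 F N ε₀ ε₂₉ B₃ B₃' a₀ a₁) p) j)) ^ 2) <
        (theta13OfThm1CC1 F N ε₀ ε₂₉ B₃ B₃' a₀ a₁).s2.cB * (lfOfRecord₁₂ F N (theta13OfThm1CC1 F N ε₀ ε₂₉ B₃ B₃' a₀ a₁).toStage12Params).alpha0 (gOfRecord₁₃ F N (theta13OfThm1CC1 F N ε₀ ε₂₉ B₃ B₃' a₀ a₁) p j) := by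
  intro p n hn hw
  have hd : (F.P p.K).d = 4 := rfl
  have hY0 : (0 : ℝ) ≤ ((F.P p.K).L : ℝ) * (theta13OfThm1CC1 F N ε₀ ε₂₉ B₃ B₃' a₀ a₁).τ9.M := by positivity
  have hYL : ((F.P p.K).L : ℝ) * (theta13OfThm1CC1 F N ε₀ ε₂₉ B₃ B₃' a₀ a₁).τ9.M ≤ (F.L : ℕ) := by
    rw [theta13OfThm1CC1_τ9_M]; show ((F.L : ℕ) : ℝ) * ((1 : ℕ) : ℝ) ≤ (F.L : ℕ); simp
  have hΛ : (4 * (B₃ + (((F.P p.K).d - 1 : ℕ) : ℝ) * (((F.P p.K).L : ℝ) * (theta13OfThm1CC1 F N ε₀ ε₂₉ B₃ B₃' a₀ a₁).τ9.M) * B₃') +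
      16 * ((((F.P p.K).d - 1 : ℕ) : ℝ) * (((F.P p.K).L : ℝ) * (theta13OfThm1CC1 F N ε₀ ε₂₉ B₃ B₃' a₀ a₁).τ9.M)) ^ 2 * B₃ ^ 2 * a₁) * (theta13OfThm1CC1 F N ε₀ ε₂₉ B₃ B₃' a₀ a₁).s2.cR * (theta13OfThm1CC1 F N ε₀ ε₂₉ B₃ B₃' a₀ a₁).ν.A₀ ≤
      1 * (lfOfRecord₁₂ F N (theta13OfThm1CC1 F N ε₀ ε₂₉ B₃ B₃' a₀ a₁).toStage12Params).C₀ := by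
    rw [hd, lambdaOfThm1CC1_eq]; exact lambda_mul_A0_le_C₀_thm1CC1 (ε₀ := ε₀) hY0 hYL hB hB' ha₀.le ha₁.le
  have hΛ0 : 0 ≤ (4 * (B₃ + (((F.P p.K).d - 1 : ℕ) : ℝ) * (((F.P p.K).L : ℝ) * (theta13OfThm1CC1 F N ε₀ ε₂₉ B₃ B₃' a₀ a₁).τ9.M) * B₃') +
      16 * ((((F.P p.K).d - 1 : ℕ) : ℝ) * (((F.P p.K).L : ℝ) * (theta13OfThm1CC1 F N ε₀ ε₂₉ B₃ B₃' a₀ a₁).τ9.M)) ^ 2 * B₃ ^ 2 * a₁) * (theta13OfThm1CC1 F N ε₀ ε₂₉ B₃ B₃' a₀ a₁).s2.cR * (theta13OfThm1CC1 F N ε₀ ε₂₉ B₃ B₃' a₀ a₁).ν.A₀ := by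
    rw [hd, lambdaOfThm1CC1_eq]; exact lambda_mul_A0_nonneg_thm1CC1 (L := F.L) (ε₀ := ε₀) hY0 hB hB' ha₀.le ha₁.le
  have ht : (1 : ℝ) < (theta13OfThm1CC1 F N ε₀ ε₂₉ B₃ B₃' a₀ a₁).s2.cB := by
    rw [theta13OfThm1CC1_cB]; have : (1 : ℝ) ≤ F.L := by exact_mod_cast (show 1 ≤ F.L by have := F.hL11; omega)
    linarith
  exact hletterI_of_numerics (P := F.P p.K) (lfOfRecord₁₂ F N (theta13OfThm1CC1 F N ε₀ ε₂₉ B₃ B₃' a₀ a₁).toStage12Params) (theta13OfThm1CC1 F N ε₀ ε₂₉ B₃ B₃' a₀ a₁).ν (theta13OfThm1CC1 F N ε₀ ε₂₉ B₃ B₃' a₀ a₁).τ9.M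
    (fun j _ hj => hg_theta13OfThm1CC1 p n hn hw j hj) hpq_theta13OfThm1CC1 (fun j hj => ⟨(hnum_theta13OfThm1CC1 hB hB' ha₀ ha₁ p n hn hw j hj).1, (hnum_theta13OfThm1CC1 hB hB' ha₀ ha₁ p n hn hw j hj).2.1⟩)
    hΛ0 hΛ ht (fun j _ hj => hα0_theta13OfThm1CC1 p n hn hw j hj)

/-- **★ node00-def-P11's C¹-ROUTE LETTER (hletterMS) AT `θ₁₅ᶜᶜ¹`** (FILE 7c `hletterMS_of_numerics` at `t_MS = 1 < 7 = B·C·M_r`: `Λ(M)·cR·A₀ᶜᶜ¹ ≤ C₀`).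
[cite: Balaban1988Convergent, (2.4) p.255, (2.28) p.259, (2.38) p.261] -/
theorem hletterMS_theta13OfThm1CC1 (hB : 0 ≤ B₃) (hB' : 0 ≤ B₃') (ha₀ : 0 < a₀) (ha₁ : 0 < a₁) :
     ∀ (p : B12.RunParams) (n : ℕ), n ≤ p.K → Step.InInterval (theta13OfThm1CC1 F N ε₀ ε₂₉ B₃ B₃' a₀ a₁).γ n (gOfRecord₁₃ F N (theta13OfThm1CC1 F N ε₀ ε₂₉ B₃ B₃' a₀ a₁) p) → ∀ m, 1 ≤ m → m ≤ n →
      4 * (B₃ * ((theta13OfThm1CC1 F N ε₀ ε₂₉ B₃ B₃' a₀ a₁).s2.cR * epsOfRecord (theta13OfThm1CC1 F N ε₀ ε₂₉ B₃ B₃' a₀ a₁).ν (gOfRecord₁₃ F N (theta13OfThm1CC1 F N ε₀ ε₂₉ B₃ B₃' a₀ a₁) p) m) + (((F.P p.K).d - 1 : ℕ) : ℝ) * ((theta13OfThm1CC1 F N ε₀ ε₂₉ B₃ B₃' a₀ a₁).τ9.M : ℝ) * (B₃' * ((theta13OfThm1CC1 F N ε₀ ε₂₉ B₃ B₃' a₀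 a₁).s2.cR * epsOfRecord (theta13OfThm1CC1 F N ε₀ ε₂₉ B₃ B₃' a₀ a₁).ν (gOfRecord₁₃ F N (theta13OfThm1CC1 F N ε₀ ε₂₉ B₃ B₃' a₀ a₁) p) m)) +
        4 * ((((F.P p.K).d - 1 : ℕ) : ℝ) * ((theta13OfThm1CC1 F N ε₀ ε₂₉ B₃ B₃' a₀ a₁).τ9.M : ℝ)) ^ 2 * (B₃ * ((theta13OfThm1CC1 F N ε₀ ε₂₉ B₃ B₃' a₀ a₁).s2.cR * epsOfRecord (theta13OfThm1CC1 F N ε₀ ε₂₉ B₃ B₃' a₀ a₁).ν (gOfRecord₁₃ F N (theta13OfThm1CC1 F N ε₀ ε₂₉ B₃ B₃' a₀ a₁) p) m)) ^ 2) <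
        rad238 (theta13OfThm1CC1 F N ε₀ ε₂₉ B₃ B₃' a₀ a₁).s2.B (theta13OfThm1CC1 F N ε₀ ε₂₉ B₃ B₃' a₀ a₁).s2.C (theta13OfThm1CC1 F N ε₀ ε₂₉ B₃ B₃' a₀ a₁).s2.Mr ((lfOfRecord₁₂ F N (theta13OfThm1CC1 F N ε₀ ε₂₉ B₃ B₃' a₀ a₁).toStage12Params).alpha0 (gOfRecord₁₃ F N (theta13OfThm1CC1 F N ε₀ ε₂₉ B₃ B₃' a₀ a₁) p m)) := by
  intro p n hn hw
  have hd : (F.P p.K).d = 4 := rfl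
  have hY0 : (0 : ℝ) ≤ ((theta13OfThm1CC1 F N ε₀ ε₂₉ B₃ B₃' a₀ a₁).τ9.M : ℝ) := by positivity
  have hYL : ((theta13OfThm1CC1 F N ε₀ ε₂₉ B₃ B₃' a₀ a₁).τ9.M : ℝ) ≤ (F.L : ℕ) := by
    rw [theta13OfThm1CC1_τ9_M]; have := F.hL11; exact_mod_cast (by omega : 1 ≤ F.L)
  have hΛ : (4 * (B₃ + (((F.P p.K).d - 1 : ℕ) : ℝ) * ((theta13OfThm1CC1 F N ε₀ ε₂₉ B₃ B₃' a₀ a₁).τ9.M : ℝ) * B₃') +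
      16 * ((((F.P p.K).d - 1 : ℕ) : ℝ) * ((theta13OfThm1CC1 F N ε₀ ε₂₉ B₃ B₃' a₀ a₁).τ9.M : ℝ)) ^ 2 * B₃ ^ 2 * a₁) * (theta13OfThm1CC1 F N ε₀ ε₂₉ B₃ B₃' a₀ a₁).s2.cR * (theta13OfThm1CC1 F N ε₀ ε₂₉ B₃ B₃' a₀ a₁).ν.A₀ ≤
      1 * (lfOfRecord₁₂ F N (theta13OfThm1CC1 F N ε₀ ε₂₉ B₃ B₃' a₀ a₁).toStage12Params).C₀ := by
    rw [hd, lambdaOfThm1CC1_eq]; exact lambda_mul_A0_le_C₀_thm1CC1 (ε₀ := ε₀) hY0 hYL hB hB' ha₀.le ha₁.le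
  have hΛ0 : 0 ≤ (4 * (B₃ + (((F.P p.K).d - 1 : ℕ) : ℝ) * ((theta13OfThm1CC1 F N ε₀ ε₂₉ B₃ B₃' a₀ a₁).τ9.M : ℝ) * B₃') +
      16 * ((((F.P p.K).d - 1 : ℕ) : ℝ) * ((theta13OfThm1CC1 F N ε₀ ε₂₉ B₃ B₃' a₀ a₁).τ9.M : ℝ)) ^ 2 * B₃ ^ 2 * a₁) * (theta13OfThm1CC1 F N ε₀ ε₂₉ B₃ B₃' a₀ a₁).s2.cR * (theta13OfThm1CC1 F N ε₀ ε₂₉ B₃ B₃' a₀ a₁).ν.A₀ := by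
    rw [hd, lambdaOfThm1CC1_eq]; exact lambda_mul_A0_nonneg_thm1CC1 (L := F.L) (ε₀ := ε₀) hY0 hB hB' ha₀.le ha₁.le
  have ht : (1 : ℝ) < (theta13OfThm1CC1 F N ε₀ ε₂₉ B₃ B₃' a₀ a₁).s2.B * (theta13OfThm1CC1 F N ε₀ ε₂₉ B₃ B₃' a₀ a₁).s2.C * (theta13OfThm1CC1 F N ε₀ ε₂₉ B₃ B₃' a₀ a₁).s2.Mr := by
    rw [theta13OfThm1CC1_B, theta13OfThm1CC1_C, theta13OfThm1CC1_Mr]; norm_num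
  exact hletterMS_of_numerics (P := F.P p.K) (lfOfRecord₁₂ F N (theta13OfThm1CC1 F N ε₀ ε₂₉ B₃ B₃' a₀ a₁).toStage12Params) (theta13OfThm1CC1 F N ε₀ ε₂₉ B₃ B₃' a₀ a₁).ν (theta13OfThm1CC1 F N ε₀ ε₂₉ B₃ B₃' a₀ a₁).τ9.M
    (fun m _ hm => hg_theta13OfThm1CC1 p n hn hw m hm) hpq_theta13OfThm1CC1 (fun m hm => ⟨(hnum_theta13OfThm1CC1 hB hB' ha₀ ha₁ p n hn hw m hm).1, (hnum_theta13OfThm1CC1 hB hB' ha₀ ha₁ p n hn hw m hm).2.1⟩)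
    hΛ0 hΛ ht (fun m _ hm => hα0_theta13OfThm1CC1 p n hn hw m hm)

/-- **node00-def-P11's (hcomp) AT `θ₁₅ᶜᶜ¹` from the MONOTONICITY of the windowed history** (FILE 11c's profile lemma; for the stub provers of the C⁰ clause from a
comparable-threshold fact). [cite: Balaban1988Convergent, (2.4) p.255, (2.7)–(2.8) pp.255–256; Balaban1987RG1, Thm 1 p.259] -/
theorem hcomp_theta13OfThm1CC1_of_monotone (hB : 0 ≤ B₃) (hB' : 0 ≤ B₃') (ha₀ : 0 ≤ a₀) (ha₁ : 0 ≤ a₁)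
    (hmono : ∀ (p : B12.RunParams) (n : ℕ), n ≤ p.K → Step.InInterval (theta13OfThm1CC1 F N ε₀ ε₂₉ B₃ B₃' a₀ a₁).γ n (gOfRecord₁₃ F N (theta13OfThm1CC1 F N ε₀ ε₂₉ B₃ B₃' a₀ a₁) p) → ∀ m, m < n →
      gOfRecord₁₃ F N (theta13OfThm1CC1 F N ε₀ ε₂₉ B₃ B₃' a₀ a₁) p m ≤ gOfRecord₁₃ F N (theta13OfThm1CC1 F N ε₀ ε₂₉ B₃ B₃' a₀ a₁) p (m + 1)) :
     ∀ (p : B12.RunParams) (n : ℕ), n ≤ p.K → Step.InInterval (theta13OfThm1CC1 F N ε₀ ε₂₉ B₃ B₃' a₀ a₁).γ n (gOfRecord₁₃ F N (theta13OfThm1CC1 F N ε₀ ε₂₉ B₃ B₃' a₀ a₁) p) → ∀ m, m < n →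
      (theta13OfThm1CC1 F N ε₀ ε₂₉ B₃ B₃' a₀ a₁).s2.cR * epsOfRecord (theta13OfThm1CC1 F N ε₀ ε₂₉ B₃ B₃' a₀ a₁).ν (gOfRecord₁₃ F N (theta13OfThm1CC1 F N ε₀ ε₂₉ B₃ B₃' a₀ a₁) p) m ≤ 2 * ((theta13OfThm1CC1 F N ε₀ ε₂₉ B₃ B₃' a₀ a₁).s2.cR * epsOfRecord (theta13OfThm1CC1 F N ε₀ ε₂₉ B₃ B₃' a₀ a₁).ν (gOfRecord₁₃ F N (theta13OfThm1CC1 F N ε₀ ε₂₉ B₃ B₃' a₀ a₁) p) (m + 1)) := by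
  intro p n hn hw m hm
  rw [theta13OfThm1CC1_cR, one_mul, one_mul]
  have hγ := theta13OfThm1CC1_γ F N ε₀ ε₂₉ B₃ B₃' a₀ a₁
  have h0 : 0 < gOfRecord₁₃ F N (theta13OfThm1CC1 F N ε₀ ε₂₉ B₃ B₃' a₀ a₁) p m := (hw m hm.le).1
  have hhalf : gOfRecord₁₃ F N (theta13OfThm1CC1 F N ε₀ ε₂₉ B₃ B₃' a₀ a₁) p (m + 1) ≤ 1 / 2 := (hw (m + 1) hm).2.trans hγ.le
  exact epsOfRecord_le_two_mul_of_le _ (theta13OfThm1CC1_p₀ F N ε₀ ε₂₉ B₃ B₃' a₀ a₁)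
    (by rw [theta13OfThm1CC1_A₀]; exact A0OfThm1CC1_nonneg hB hB' ha₀ ha₁) h0 (hmono p n hn hw m hm) hhalf

end Faces

/-! ## §3. ★★★ THE v1.2 ROW P11 AT `θ₁₅ᶜᶜ¹`, PER PARTITION-COMPATIBLE RUN, FROM THE TWO CLASS CLAUSES THERE — NOTHING ELSE -/

section AtWitness

variable {F : T4Family} {N : ℕ} [NeZero N] {ε₀ ε₂₉ B₃ B₃' a₀ a₁ : ℝ}

/-- **★★★ THE SEPARATION-GUARDED ROW P11 AT `θ₁₅ᶜᶜ¹ = theta13OfThm1CC1 F N ε₀ ε₂₉ B₃ B₃' a₀ a₁`, PER PARTITION-COMPATIBLE RUN, FROM THE TWO CLASS CLAUSES** — under the signs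
`0 < ε₀`, `0 < ε₂₉`, `0 ≤ B₃`, `0 ≤ B₃′`, `0 < a₀`, `0 < a₁`: the C⁰ clause (hclass) «def-R's background of every separated sequence over regular retained data admitting a minimiser
in print's class has `|U(∂p) − 1| < B₃·cR·ε_m·η_m²` on the plaquettes of `Ω_m`» ([15] Thm 1 (8)) and the C¹ clause (hclassC1) «… and covariant plaquette differences `< B₃′·cR·ε_m·η_m³`
inside `Ω_m`» ((9)–(10), gauge-free reading) IMPLY the body of v1.2's `Provisos₁₃Sep.bg` at `θ₁₅ᶜᶜ¹` — every numerics letter, (C1), no wrapping and both C¹-route letters by §2, (C2) from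
the antecedent.  NO named fact, NO (hcomp), NO (h3I)∕(h3MS).  CONDITIONAL on the two clauses; nothing of Bałaban asserted.
[cite: Balaban1985Variational, Thm 1 (8)–(10) p.279; Balaban1985RegularSpaces, (1.3)–(1.8) p.77; Balaban1988Convergent, (2.10) p.256, (2.27)–(2.28) p.259, (2.34)–(2.41) p.261, p.257; Balaban1987RG1, (1.11)–(1.16) p.262] -/
theorem bgSepAt_theta13OfThm1CC1_of_classBounds (hε : 0 < ε₀) (hε' : 0 < ε₂₉) (hB : 0 ≤ B₃) (hB' : 0 ≤ B₃') (ha₀ : 0 < a₀) (ha₁ : 0 < a₁)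
    (hclass : ∀ (p : B12.RunParams) (n : ℕ), n ≤ p.K → Step.InInterval (theta13OfThm1CC1 F N ε₀ ε₂₉ B₃ B₃' a₀ a₁).γ n (gOfRecord₁₃ F N (theta13OfThm1CC1 F N ε₀ ε₂₉ B₃ B₃' a₀ a₁) p) → PartCompat₁₃ F N (theta13OfThm1CC1 F N ε₀ ε₂₉ B₃ B₃' a₀ a₁) p n →
      ∀ s : SeqOfRecord F (theta13OfThm1CC1 F N ε₀ ε₂₉ B₃ B₃' a₀ a₁).ν (theta13OfThm1CC1 F N ε₀ ε₂₉ B₃ B₃' a₀ a₁).τ9.M (gOfRecord₁₃ F N (theta13OfThm1CC1 F N ε₀ ε₂₉ B₃ B₃' a₀ a₁) p) p.K n, Sect2.SeqSeparated (theta13OfThm1CC1 F N ε₀ ε₂₉ B₃ B₃' a₀ a₁).ν.M₁ s → ∀ W : MSField (F.P p.K) (SU N),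
      W ∈ suppOfRecord₁₃ F N (theta13OfThm1CC1 F N ε₀ ε₂₉ B₃ B₃' a₀ a₁) p n s → W ∈ solvableDom (avOfRecord F N p.K) (regMSOfRecord F N (theta13OfThm1CC1 F N ε₀ ε₂₉ B₃ B₃' a₀ a₁).ν p.K n s.Ω) (genSet s.Ω n) →
      ∀ m, m ≤ n → PlaqSmallOn (omegaPlaqs s.Ω m) (B₃ * ((theta13OfThm1CC1 F N ε₀ ε₂₉ B₃ B₃' a₀ a₁).s2.cR * epsOfRecord (theta13OfThm1CC1 F N ε₀ ε₂₉ B₃ B₃' a₀ a₁).ν (gOfRecord₁₃ F N (theta13OfThm1CC1 F N ε₀ ε₂₉ B₃ B₃' a₀ a₁) p) m) * (F.P p.K).eta m ^ 2)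
        (UbgMSOfRecord F N (theta13OfThm1CC1 F N ε₀ ε₂₉ B₃ B₃' a₀ a₁).ν (theta13OfThm1CC1 F N ε₀ ε₂₉ B₃ B₃' a₀ a₁).τ9.M (gOfRecord₁₃ F N (theta13OfThm1CC1 F N ε₀ ε₂₉ B₃ B₃' a₀ a₁) p) p.K n s W))
    (hclassC1 : ∀ (p : B12.RunParams) (n : ℕ), n ≤ p.K → Step.InInterval (theta13OfThm1CC1 F N ε₀ ε₂₉ B₃ B₃' a₀ a₁).γ n (gOfRecord₁₃ F N (theta13OfThm1CC1 F N ε₀ ε₂₉ B₃ B₃' a₀ a₁) p) → PartCompat₁₃ F N (theta13OfThm1CC1 F N ε₀ ε₂₉ B₃ B₃' a₀ a₁) p n →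
      ∀ s : SeqOfRecord F (theta13OfThm1CC1 F N ε₀ ε₂₉ B₃ B₃' a₀ a₁).ν (theta13OfThm1CC1 F N ε₀ ε₂₉ B₃ B₃' a₀ a₁).τ9.M (gOfRecord₁₃ F N (theta13OfThm1CC1 F N ε₀ ε₂₉ B₃ B₃' a₀ a₁) p) p.K n, Sect2.SeqSeparated (theta13OfThm1CC1 F N ε₀ ε₂₉ B₃ B₃' a₀ a₁).ν.M₁ s → ∀ W : MSField (F.P p.K) (SU N),
      W ∈ suppOfRecord₁₃ F N (theta13OfThm1CC1 F N ε₀ ε₂₉ B₃ B₃' a₀ a₁) p n s → W ∈ solvableDom (avOfRecord F N p.K) (regMSOfRecord F N (theta13OfThm1CC1 F N ε₀ ε₂₉ B₃ B₃' a₀ a₁).ν p.K n s.Ω) (genSet s.Ω n) →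
      ∀ m, 1 ≤ m → m ≤ n → PlaqC1SmallOn (plaqInside (s.Ω m)) (B₃' * ((theta13OfThm1CC1 F N ε₀ ε₂₉ B₃ B₃' a₀ a₁).s2.cR * epsOfRecord (theta13OfThm1CC1 F N ε₀ ε₂₉ B₃ B₃' a₀ a₁).ν (gOfRecord₁₃ F N (theta13OfThm1CC1 F N ε₀ ε₂₉ B₃ B₃' a₀ a₁) p) m) * (F.P p.K).eta m ^ 3)
        (UbgMSOfRecord F N (theta13OfThm1CC1 F N ε₀ ε₂₉ B₃ B₃' a₀ a₁).ν (theta13OfThm1CC1 F N ε₀ ε₂₉ B₃ B₃' a₀ a₁).τ9.M (gOfRecord₁₃ F N (theta13OfThm1CC1 F N ε₀ ε₂₉ B₃ B₃' a₀ a₁) p) p.K n s W)) :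
    ∀ (p : B12.RunParams) (n : ℕ), n ≤ p.K → Step.InInterval (theta13OfThm1CC1 F N ε₀ ε₂₉ B₃ B₃' a₀ a₁).γ n (gOfRecord₁₃ F N (theta13OfThm1CC1 F N ε₀ ε₂₉ B₃ B₃' a₀ a₁) p) → PartCompat₁₃ F N (theta13OfThm1CC1 F N ε₀ ε₂₉ B₃ B₃' a₀ a₁) p n →
      ∀ s : SeqOfRecord F (theta13OfThm1CC1 F N ε₀ ε₂₉ B₃ B₃' a₀ a₁).ν (theta13OfThm1CC1 F N ε₀ ε₂₉ B₃ B₃' a₀ a₁).τ9.M (gOfRecord₁₃ F N (theta13OfThm1CC1 F N ε₀ ε₂₉ B₃ B₃' a₀ a₁) p) p.K n, Sect2.SeqSeparated (theta13OfThm1CC1 F N ε₀ ε₂₉ B₃ B₃' a₀ a₁).ν.M₁ s →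
      ∀ W : MSField (F.P p.K) (SU N), W ∈ suppOfRecord₁₃ F N (theta13OfThm1CC1 F N ε₀ ε₂₉ B₃ B₃' a₀ a₁) p n s →
      ∀ j, 1 ≤ j → j ≤ n → ∀ X : (Sect2.domSys (F.P p.K) (theta13OfThm1CC1 F N ε₀ ε₂₉ B₃ B₃' a₀ a₁).τ9.M j).Dom,
      (Sect2.domSites (F.P p.K) (theta13OfThm1CC1 F N ε₀ ε₂₉ B₃ B₃' a₀ a₁).τ9.M j X ⊆ s.Λ j →
        Sect2.ofBackgroundC (settingOfRecord₁₃ F N (theta13OfThm1CC1 F N ε₀ ε₂₉ B₃ B₃' a₀ a₁) p).ι (UbgOfRecord₁₃ F N (theta13OfThm1CC1 F N ε₀ ε₂₉ B₃ B₃' a₀ a₁) p n s W) ∈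
          Sect2.spaceI (settingOfRecord₁₃ F N (theta13OfThm1CC1 F N ε₀ ε₂₉ B₃ B₃' a₀ a₁) p) ((theta13OfThm1CC1 F N ε₀ ε₂₉ B₃ B₃' a₀ a₁).Rz p.K) (theta13OfThm1CC1 F N ε₀ ε₂₉ B₃ B₃' a₀ a₁).τ9.M j (Sect2.domSites (F.P p.K) (theta13OfThm1CC1 F N ε₀ ε₂₉ B₃ B₃' a₀ a₁).τ9.M j X)
            ((settingOfRecord₁₃ F N (theta13OfThm1CC1 F N ε₀ ε₂₉ B₃ B₃' a₀ a₁) p).lf.alpha0 ((settingOfRecord₁₃ F N (theta13OfThm1CC1 F N ε₀ ε₂₉ B₃ B₃' a₀ a₁) p).flow.g j)) ((settingOfRecord₁₃ F N (theta13OfThm1CC1 F N ε₀ ε₂₉ B₃ B₃' a₀ a₁) p).lf.alpha1 ((settingOfRecord₁₃ F N (theta13OfThm1CC1 F N ε₀ ε₂₉ B₃ B₃' a₀ a₁) p).flow.g j))) ∧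
      (Sect2.admB (F.P p.K) (theta13OfThm1CC1 F N ε₀ ε₂₉ B₃ B₃' a₀ a₁).ν (theta13OfThm1CC1 F N ε₀ ε₂₉ B₃ B₃' a₀ a₁).τ9.M (gOfRecord₁₃ F N (theta13OfThm1CC1 F N ε₀ ε₂₉ B₃ B₃' a₀ a₁) p) s.Ω s.Λ j (Sect2.domSites (F.P p.K) (theta13OfThm1CC1 F N ε₀ ε₂₉ B₃ B₃' a₀ a₁).τ9.M j X) = true →
        Sect2.ofBackgroundC (settingOfRecord₁₃ F N (theta13OfThm1CC1 F N ε₀ ε₂₉ B₃ B₃' a₀ a₁) p).ι (UbgOfRecord₁₃ F N (theta13OfThm1CC1 F N ε₀ ε₂₉ B₃ B₃' a₀ a₁) p n s W) ∈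
          Sect2.spaceMS (settingOfRecord₁₃ F N (theta13OfThm1CC1 F N ε₀ ε₂₉ B₃ B₃' a₀ a₁) p) ((theta13OfThm1CC1 F N ε₀ ε₂₉ B₃ B₃' a₀ a₁).Rz p.K) (theta13OfThm1CC1 F N ε₀ ε₂₉ B₃ B₃' a₀ a₁).τ9.M j (Sect2.domSites (F.P p.K) (theta13OfThm1CC1 F N ε₀ ε₂₉ B₃ B₃' a₀ a₁).τ9.M j X) s.Ω) :=
  (theta13OfThm1CC1 F N ε₀ ε₂₉ B₃ B₃' a₀ a₁).bgSepAt_of_classBoundsC1 (admissible_theta13OfThm1CC1 F N hε hε' hB hB' ha₀ ha₁) rfl hB hB'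
    (by rw [theta13OfThm1CC1_τ9_M]; exact Nat.one_pos) (hε0_theta13OfThm1CC1 hB hB' ha₀ ha₁) (hBα_theta13OfThm1CC1 hB hB' ha₀.le ha₁.le) hsN_theta13OfThm1CC1 hcB_theta13OfThm1CC1 hBCM_theta13OfThm1CC1
    (hsmallI_theta13OfThm1CC1 hB hB' ha₀ ha₁) (hsmallMS_theta13OfThm1CC1 hB hB' ha₀ ha₁) hC1_theta13OfThm1CC1 (hletterI_theta13OfThm1CC1 hB hB' ha₀ ha₁) (hletterMS_theta13OfThm1CC1 hB hB' ha₀ ha₁)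
    hclass hclassC1

end AtWitness

end Literature.MathematicalPhysics.QuantumFieldTheory.Balaban1983to89.Node00

end
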